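import Literature.AlgebraicGeometry.AbelianVarieties.MarkmanShearFourierFunctor
import Literature.AlgebraicGeometry.AbelianVarieties.FourierMukaiExchangeTranslation
import HarnessLib

/-!
# Exchange rows for the RELATIVE integral transform `id_A × Ψ_K : D⁺(Mod 𝒪_{A×B}) ⥤ D⁺(Mod 𝒪_{A×C})`:
# translation of the `A`-factor passes through; a twist by `pr_B^*L` becomes a translation of the `C`-factor when
# `t_{(1,c)}^*K ≅ K ⊗ pr_B^*L` (Mukai 1981 (3.1) relative form; Markman 2025 §6)

Layer `Literature/AlgebraicGeometry/AbelianVarieties`; sequel to `MarkmanShearFourierFunctor` (`relativeIntegralTransformPlus A B C K`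
= `E• ↦ R(pr₁₃)_*(pr₂₃^*K ⊗ pr₁₂^*E•)` on `(A × B) × C`, kernel a line bundle `K` on `B × C`) and to the absolute rows
`FourierMukaiExchangeTensor` ∕ `FourierMukaiExchangeTranslation`. For complex abelian varieties `A`, `B`, `C` this file PROVES
(0 named facts, no instances), as isomorphisms of FUNCTORS:

* §1∕§3 **`relativeTransform_translationFst_iso` — `D⁺(t_{(a,1)}^*) ⋙ (id × Ψ_K) ≅ (id × Ψ_K) ⋙ D⁺(t_{(a,1)}^*)`** for a point `a` of `A`
  (translations of the passive factor `A` commute with the relative transform: pure base change along the automorphism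
  `t_{(a,1,1)}` of the triple product, whose squares with `pr₁₂`, `pr₁₃`, `pr₂₃` are translations ∕ the identity);
* §2∕§4 **`relativeTransform_twist_iso` — `D⁺(pr_B^*L ⊗ –) ⋙ (id × Ψ_K) ≅ (id × Ψ_K) ⋙ D⁺(t_{(1,c)}^*)`** for a point `c` of `C` and a line
  bundle `L` on `B`, GIVEN an isomorphism `φ : t_{(1,c)}^*K ≅ K ⊗ pr_B^*L` on `B × C` (the relative form of Mukai's tensor row; the
  datum `φ` is where a Poincaré-type formula enters — for `K = 𝒫^∨`, `L = P_α^∨` it is Lange's Lemma 6.1.3, see `MarkmanPhiExchange`).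

Pattern of proof = the absolute rows': a NATURAL isomorphism of kernel functors on ALL of `Mod(𝒪_{A×B})`
(`Modules/PullbackTensorOfLocallyFree`, associator, Mathlib `pullbackComp`), `D⁺` of it (`Algebra/Homology/RightDerivedFunctorPlusComp`),
and base change of `R(pr₁₃)_*` along an automorphism square (`Modules/DerivedPushforwardIsoBaseChange`). No projection formula is
needed for these two rows. NOT here: the rows in which the translation acts on the `B`-factor of the source (those are relative
forms of the translation row and need the projection formula), compatibilities between rows. Typed for the cell `pub-hodge-ring2`
(plate F11 of the (M1) library debt of crux 26512: the `e₂ ↦ e₁` bridge of the sockets through Markman's `Φ`); a research route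
conditional on HC_CM, not a corollary — nothing in this file refers to it.

## References

* S. Mukai, *Duality between `D(X)` and `D(X̂)`…*, Nagoya Math. J. 81 (1981), §3 (3.1) p. 158. [Mukai1981]
* E. Markman, *Cycles on abelian 2n-folds of Weil type…*, arXiv:2502.03415 (2025), §5 p. 24 L10–23 (`Φ_F`, `Ψ_F`), §6 p. 26
  L34–51 (`id × Φ_𝒫`, `Φ`), §9.3 p. 71 L46–69 (conjugating translations through `Φ̃`). [Markman2025SecantWeil]
* R. Hartshorne, *Algebraic Geometry* (1977), III Prop. 9.3 (base change, here along isomorphisms). [Hartshorne1977]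
-/

noncomputable section

-- `TopCat.Presheaf`/`Scheme.Modules` are not reducible (as in Mathlib's `AlgebraicGeometry/Modules/Sheaf.lean`).
set_option backward.isDefEq.respectTransparency false

open CategoryTheory CategoryTheory.Limits AlgebraicGeometry MonoidalCategory CartesianMonoidalCategory
open AlgebraicGeometry.Scheme.Modules

universe w₁ w₂ w₃ u

namespace Literature.AlgebraicGeometry.AbelianVarieties

open Literature.AlgebraicGeometry.Motives Literature.AlgebraicGeometry.Modules
open scoped MonObj

variable (A B C : AbelianVariety ℂ)

/-! ### §1 Translating the `A`-factor: the automorphism `t_a × 1 × 1` of `(A × B) × C` and its squares -/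

section TranslateFst

variable (a : A.Points ℂ)

/-- **`t_a × 1_X` as an isomorphism of schemes `A × X ≅ A × X`** (translation of the first factor; `t_a ▷ X` in the cartesian
monoidal category of `ℂ`-schemes). [cite: GortzWedhorn2023, Def./Rem. 27.1 (p. 799)] -/
def fstTranslationIso (X : AbelianVariety ℂ) : (A.X ⊗ X.X).left ≅ (A.X ⊗ X.X).left :=
  (Over.forget _).mapIso (whiskerRightIso (A.translationIso a) X.X)

/-- **`t_a × 1_B × 1_C` as an isomorphism of schemes of `(A × B) × C`.** [cite: GortzWedhorn2023, Def./Rem. 27.1 (p. 799)] -/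
def fstTranslationIso₃ : ((A.X ⊗ B.X) ⊗ C.X).left ≅ ((A.X ⊗ B.X) ⊗ C.X).left :=
  (Over.forget _).mapIso (whiskerRightIso (whiskerRightIso (A.translationIso a) B.X) C.X)

/-- **`(t_a × 1 × 1) ≫ pr₁₂ = pr₁₂ ≫ (t_a × 1)`.** [cite: GortzWedhorn2023, Def./Rem. 27.1 (p. 799)] -/
theorem fstTranslation₃_comp_pr₁₂ :
    (fstTranslationIso₃ A B C a).hom ≫ (pr₁₂ A B C).left = (pr₁₂ A B C).left ≫ (fstTranslationIso A a B).hom := by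
  change ((A.translation a ▷ B.X) ▷ C.X).left ≫ (fst (A.X ⊗ B.X) C.X).left = (fst (A.X ⊗ B.X) C.X).left ≫ (A.translation a ▷ B.X).left
  rw [← Over.comp_left, ← Over.comp_left, whiskerRight_fst]

/-- **`(t_a × 1 × 1) ≫ pr₂₃ = pr₂₃`.** [cite: GortzWedhorn2023, Def./Rem. 27.1 (p. 799)] -/
theorem fstTranslation₃_comp_pr₂₃ : (fstTranslationIso₃ A B C a).hom ≫ (pr₂₃ A B C).left = (pr₂₃ A B C).left := by
  change ((A.translation a ▷ B.X) ▷ C.X).left ≫ (pr₂₃ A B C).left = _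
  rw [← Over.comp_left]
  congr 1
  ext <;> simp

/-- **`pr₁₃ ≫ (t_a × 1) = (t_a × 1 × 1) ≫ pr₁₃`** (the square over which `R(pr₁₃)_*` is base-changed). [cite: GortzWedhorn2023, Def./Rem. 27.1 (p. 799)] -/
theorem pr₁₃_comp_fstTranslation :
    (pr₁₃ A B C).left ≫ (fstTranslationIso A a C).hom = (fstTranslationIso₃ A B C a).hom ≫ (pr₁₃ A B C).left := by
  change (pr₁₃ A B C).left ≫ (A.translation a ▷ C.X).left = ((A.translation a ▷ B.X) ▷ C.X).left ≫ (pr₁₃ A B C).left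
  rw [← Over.comp_left, ← Over.comp_left]
  congr 1
  ext <;> simp

/-- `(t_a × 1)^*` is left exact (pull-back along an isomorphism). [cite: Hartshorne1977, II §5 p. 110] -/
theorem preservesFiniteLimits_pullback_fstTranslation (X : AbelianVariety ℂ) :
    PreservesFiniteLimits (Scheme.Modules.pullback (fstTranslationIso A a X).hom) :=
  preservesFiniteLimits_pullback_of_iso _

end TranslateFst

/-! ### §2 Translating the `C`-factor: the automorphism `1 × 1 × t_c` of `(A × B) × C` and its squares -/

section TranslateThird

variable (c : C.Points ℂ)

/-- **`1_X × t_c` as an isomorphism of schemes of `X × C`** (`X ◁ t_c`). [cite: GortzWedhorn2023, Def./Rem. 27.1 (p. 799)] -/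
def sndTranslationIso (X : AbelianVariety ℂ) : (X.X ⊗ C.X).left ≅ (X.X ⊗ C.X).left :=
  (Over.forget _).mapIso (whiskerLeftIso X.X (C.translationIso c))

/-- **`1_A × 1_B × t_c` as an isomorphism of schemes of `(A × B) × C`.** [cite: GortzWedhorn2023, Def./Rem. 27.1 (p. 799)] -/
def thirdTranslationIso₃ : ((A.X ⊗ B.X) ⊗ C.X).left ≅ ((A.X ⊗ B.X) ⊗ C.X).left :=
  (Over.forget _).mapIso (whiskerLeftIso (A.X ⊗ B.X) (C.translationIso c))

/-- **`(1 × 1 × t_c) ≫ pr₁₂ = pr₁₂`.** [cite: GortzWedhorn2023, Def./Rem. 27.1 (p. 799)] -/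
theorem thirdTranslation₃_comp_pr₁₂ : (thirdTranslationIso₃ A B C c).hom ≫ (pr₁₂ A B C).left = (pr₁₂ A B C).left := by
  change ((A.X ⊗ B.X) ◁ C.translation c).left ≫ (fst (A.X ⊗ B.X) C.X).left = _
  rw [← Over.comp_left, whiskerLeft_fst]

/-- **`(1 × 1 × t_c) ≫ pr₂₃ = pr₂₃ ≫ (1 × t_c)`** on `B × C`. [cite: GortzWedhorn2023, Def./Rem. 27.1 (p. 799)] -/
theorem thirdTranslation₃_comp_pr₂₃ :
    (thirdTranslationIso₃ A B C c).hom ≫ (pr₂₃ A B C).left = (pr₂₃ A B C).left ≫ (sndTranslationIso C c B).hom := by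
  change ((A.X ⊗ B.X) ◁ C.translation c).left ≫ (pr₂₃ A B C).left = (pr₂₃ A B C).left ≫ (B.X ◁ C.translation c).left
  rw [← Over.comp_left, ← Over.comp_left]
  congr 1
  ext <;> simp

/-- **`pr₁₃ ≫ (1 × t_c) = (1 × 1 × t_c) ≫ pr₁₃`** on `A × C`. [cite: GortzWedhorn2023, Def./Rem. 27.1 (p. 799)] -/
theorem pr₁₃_comp_sndTranslation :
    (pr₁₃ A B C).left ≫ (sndTranslationIso C c A).hom = (thirdTranslationIso₃ A B C c).hom ≫ (pr₁₃ A B C).left := by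
  change (pr₁₃ A B C).left ≫ (A.X ◁ C.translation c).left = ((A.X ⊗ B.X) ◁ C.translation c).left ≫ (pr₁₃ A B C).left
  rw [← Over.comp_left, ← Over.comp_left]
  congr 1
  ext <;> simp

/-- `(1 × t_c)^*` is left exact (pull-back along an isomorphism). [cite: Hartshorne1977, II §5 p. 110] -/
theorem preservesFiniteLimits_pullback_sndTranslation (X : AbelianVariety ℂ) :
    PreservesFiniteLimits (Scheme.Modules.pullback (sndTranslationIso C c X).hom) :=
  preservesFiniteLimits_pullback_of_iso _

end TranslateThird

/-! ### §3 Row (i): translation of the `A`-factor passes through `id × Ψ_K` -/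

section RowFst

variable (K : (B.X ⊗ C.X).left.Modules) (hK : IsFiniteLocallyFree K) (hK₁ : HasRank K 1) (a : A.Points ℂ)

/-- The kernel functor `E ↦ pr₂₃^*K ⊗ pr₁₂^*E` of the relative transform (abbreviation). [cite: Markman2025SecantWeil, §6 p. 26 L35–36] -/
abbrev relativeKernelFunctor : (A.X ⊗ B.X).left.Modules ⥤ ((A.X ⊗ B.X) ⊗ C.X).left.Modules :=
  integralKernelFunctor (pr₁₂ A B C).left ((Scheme.Modules.pullback (pr₂₃ A B C).left).obj K)

/-- `(t_a × 1)^* ⋙ pr₁₂^* ≅ pr₁₂^* ⋙ (t_a × 1 × 1)^*` from the square `t_{(a,1,1)} ≫ pr₁₂ = pr₁₂ ≫ t_{(a,1)}`. [cite: GortzWedhorn2023, Def./Rem. 27.1 (p. 799)] -/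
def pullbackTranslateFstCompPr₁₂Iso :
    Scheme.Modules.pullback (fstTranslationIso A a B).hom ⋙ Scheme.Modules.pullback (pr₁₂ A B C).left ≅
      Scheme.Modules.pullback (pr₁₂ A B C).left ⋙
        Scheme.Modules.pullback (fstTranslationIso₃ A B C a).hom :=
  pullbackComp _ _ ≪≫ pullbackCongr (fstTranslation₃_comp_pr₁₂ A B C a).symm ≪≫ (pullbackComp _ _).symm

/-- `pr₂₃^*K ≅ t_{(a,1,1)}^*(pr₂₃^*K)` from `t_{(a,1,1)} ≫ pr₂₃ = pr₂₃`. [cite: GortzWedhorn2023, Def./Rem. 27.1 (p. 799)] -/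
def pullbackPr₂₃IsoTranslateFst :
    (Scheme.Modules.pullback (pr₂₃ A B C).left).obj K ≅
      (Scheme.Modules.pullback (fstTranslationIso₃ A B C a).hom).obj
        ((Scheme.Modules.pullback (pr₂₃ A B C).left).obj K) :=
  ((pullbackCongr (fstTranslation₃_comp_pr₂₃ A B C a).symm ≪≫ (pullbackComp _ _).symm).app K)

include hK in
/-- **Kernel functor, row (i)**: `pr₂₃^*K ⊗ pr₁₂^*(t_{(a,1)}^*E) ≅ t_{(a,1,1)}^*(pr₂₃^*K ⊗ pr₁₂^*E)`, naturally on all of `Mod(𝒪_{A×B})`.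
[cite: Mukai1981, §3 p. 158 L1–9] -/
def relativeKernelTranslationFstNatIso :
    Scheme.Modules.pullback (fstTranslationIso A a B).hom ⋙ relativeKernelFunctor A B C K ≅
      relativeKernelFunctor A B C K ⋙
        Scheme.Modules.pullback (fstTranslationIso₃ A B C a).hom :=
  let τ := (fstTranslationIso₃ A B C a).hom
  let Q := (Scheme.Modules.pullback (pr₂₃ A B C).left).obj K
  have hQ : IsFiniteLocallyFree Q := hK.pullback _
  (Functor.associator _ _ _).symm ≪≫
    Functor.isoWhiskerRight (pullbackTranslateFstCompPr₁₂Iso A B C a) _ ≪≫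
    Functor.associator _ _ _ ≪≫
    Functor.isoWhiskerLeft (Scheme.Modules.pullback (pr₁₂ A B C).left)
      (Functor.isoWhiskerLeft (Scheme.Modules.pullback τ)
          ((tensorBifunctor _).mapIso (pullbackPr₂₃IsoTranslateFst A B C K a)) ≪≫
        (pullbackTensorNatIsoOfLeft τ hQ).symm) ≪≫
    (Functor.associator _ _ _).symm

variable [HasDerivedCategory.{w₁} (A.X ⊗ B.X).left.Modules] [HasDerivedCategory.{w₂} ((A.X ⊗ B.X) ⊗ C.X).left.Modules]
  [HasDerivedCategory.{w₃} (A.X ⊗ C.X).left.Modules]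

/-- **ROW (i): `D⁺(t_{(a,1)}^*) ⋙ (id × Ψ_K) ≅ (id × Ψ_K) ⋙ D⁺(t_{(a,1)}^*)`** — translating the passive factor `A` commutes with the
relative integral transform (base change along the automorphism `t_{(a,1,1)}`, squares with `pr₁₃`). Exactness instances of the two
`t_{(a,1)}^*` are binders (discharge with `preservesFiniteLimits_pullback_fstTranslation`). [cite: Mukai1981, §3 (3.1) p. 158]
[cite: Markman2025SecantWeil, §9.3 p. 71 L46–69] [cite: Hartshorne1977, III Prop. 9.3] -/
def relativeTransform_translationFst_iso
    [PreservesFiniteLimits (Scheme.Modules.pullback (fstTranslationIso A a B).hom)]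
    [PreservesFiniteLimits (Scheme.Modules.pullback (fstTranslationIso A a C).hom)] :
    (Scheme.Modules.pullback (fstTranslationIso A a B).hom).mapDerivedCategoryPlus ⋙
        relativeIntegralTransformPlus A B C K hK hK₁ ≅
      relativeIntegralTransformPlus A B C K hK hK₁ ⋙
        (Scheme.Modules.pullback (fstTranslationIso A a C).hom).mapDerivedCategoryPlus := by
  haveI := preservesFiniteLimits_pullback_pr₁₂ A B C
  haveI := preservesFiniteLimits_tensor_pullback_pr₂₃ A B C K hK hK₁
  haveI := preservesFiniteColimits_tensor_pullback_pr₂₃ A B C K hK hK₁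
  haveI := additive_integralKernelFunctor (pr₁₂ A B C).left ((Scheme.Modules.pullback (pr₂₃ A B C).left).obj K)
  haveI := preservesFiniteLimits_integralKernelFunctor (pr₁₂ A B C).left ((Scheme.Modules.pullback (pr₂₃ A B C).left).obj K)
  haveI := preservesFiniteColimits_integralKernelFunctor (pr₁₂ A B C).left ((Scheme.Modules.pullback (pr₂₃ A B C).left).obj K)
  haveI := preservesFiniteLimits_pullback_of_iso (fstTranslationIso₃ A B C a)
  let G := relativeKernelFunctor A B C K
  let t := Scheme.Modules.pullback (fstTranslationIso A a B).hom
  let τ := Scheme.Modules.pullback (fstTranslationIso₃ A B C a).hom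
  let q := (pr₁₃ A B C).left
  exact (Functor.associator _ _ _).symm ≪≫
    Functor.isoWhiskerRight ((Functor.mapDerivedCategoryPlusCompIso t G).symm ≪≫
      Functor.mapDerivedCategoryPlusIsoOfIso _ _ (relativeKernelTranslationFstNatIso A B C K hK a) ≪≫
      Functor.mapDerivedCategoryPlusCompIso G τ) (derivedPushforwardPlus q) ≪≫
    Functor.associator _ _ _ ≪≫
    Functor.isoWhiskerLeft G.mapDerivedCategoryPlus
      (derivedPushforwardPlusBaseChangeIsoOfIso q q (fstTranslationIso₃ A B C a)
        (fstTranslationIso A a C) (pr₁₃_comp_fstTranslation A B C a)) ≪≫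
    (Functor.associator _ _ _).symm

end RowFst

/-! ### §4 Row (ii): a twist by `pr_B^*L` on `A × B` becomes a translation of the `C`-factor, given `t_{(1,c)}^*K ≅ K ⊗ pr_B^*L` -/

section RowTwist

variable (K : (B.X ⊗ C.X).left.Modules) (hK : IsFiniteLocallyFree K) (hK₁ : HasRank K 1) (c : C.Points ℂ)
  {L : B.X.left.Modules} (hL : IsFiniteLocallyFree L)
  (φ : (Scheme.Modules.pullback (sndTranslationIso C c B).hom).obj K ≅
    tensorObj K ((Scheme.Modules.pullback (fst B.X C.X).left).obj L))

/-- `pr₁₂^* ≅ pr₁₂^* ⋙ t_{(1,1,c)}^*` from `t_{(1,1,c)} ≫ pr₁₂ = pr₁₂`. [cite: GortzWedhorn2023, Def./Rem. 27.1 (p. 799)] -/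
def pullbackPr₁₂IsoCompTranslateThird :
    Scheme.Modules.pullback (pr₁₂ A B C).left ≅
      Scheme.Modules.pullback (pr₁₂ A B C).left ⋙
        Scheme.Modules.pullback (thirdTranslationIso₃ A B C c).hom :=
  pullbackCongr (thirdTranslation₃_comp_pr₁₂ A B C c).symm ≪≫ (pullbackComp _ _).symm

/-- `pr₁₂^*(pr_B^*L) ≅ pr₂₃^*(pr_B^*L)` on the triple product (`pr₁₂ ≫ pr_B = pr₂₃ ≫ pr_B`, both being the middle projection).
[cite: GortzWedhorn2023, Def./Rem. 27.1 (p. 799)] -/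
def pullbackMiddleIso (L : B.X.left.Modules) :
    (Scheme.Modules.pullback (pr₁₂ A B C).left).obj ((Scheme.Modules.pullback (snd A.X B.X).left).obj L) ≅
      (Scheme.Modules.pullback (pr₂₃ A B C).left).obj ((Scheme.Modules.pullback (fst B.X C.X).left).obj L) :=
  (pullbackComp (pr₁₂ A B C).left (snd A.X B.X).left ≪≫
      pullbackCongr (show (pr₁₂ A B C).left ≫ (snd A.X B.X).left = (pr₂₃ A B C).left ≫ (fst B.X C.X).left by
        rw [← Over.comp_left, ← Over.comp_left]; congr 1; simp only [pr₂₃, lift_fst]) ≪≫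
      (pullbackComp (pr₂₃ A B C).left (fst B.X C.X).left).symm).app L

include hK hL in
/-- **The twisted kernel is the translated kernel**: `pr₂₃^*K ⊗ pr₁₂^*(pr_B^*L) ≅ t_{(1,1,c)}^*(pr₂₃^*K)` (from the datum
`φ : t_{(1,c)}^*K ≅ K ⊗ pr_B^*L`, `pr₂₃^*` of it, `pullbackTensorIso`, and the square `t_{(1,1,c)} ≫ pr₂₃ = pr₂₃ ≫ t_{(1,c)}`).
[cite: Mukai1981, §3 p. 158 L6–8] -/
def twistedKernelIso :
    tensorObj ((Scheme.Modules.pullback (pr₂₃ A B C).left).obj K)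
        ((Scheme.Modules.pullback (pr₁₂ A B C).left).obj ((Scheme.Modules.pullback (snd A.X B.X).left).obj L)) ≅
      (Scheme.Modules.pullback (thirdTranslationIso₃ A B C c).hom).obj
        ((Scheme.Modules.pullback (pr₂₃ A B C).left).obj K) :=
  ((tensorBifunctor _).obj _).mapIso (pullbackMiddleIso A B C L) ≪≫
    (pullbackTensorIso (pr₂₃ A B C).left hK (hL.pullback _)).symm ≪≫
    (Scheme.Modules.pullback (pr₂₃ A B C).left).mapIso φ.symm ≪≫
    ((pullbackComp (pr₂₃ A B C).left (sndTranslationIso C c B).hom ≪≫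
      pullbackCongr (thirdTranslation₃_comp_pr₂₃ A B C c).symm ≪≫ (pullbackComp _ _).symm).app K)

include hK hL in
/-- **Kernel functor, row (ii)**: `pr₂₃^*K ⊗ pr₁₂^*(pr_B^*L ⊗ E) ≅ t_{(1,1,c)}^*(pr₂₃^*K ⊗ pr₁₂^*E)`, naturally on all of `Mod(𝒪_{A×B})`.
[cite: Mukai1981, §3 p. 158 L1–9] -/
def relativeKernelTwistNatIso :
    (tensorBifunctor (A.X ⊗ B.X).left).obj ((Scheme.Modules.pullback (snd A.X B.X).left).obj L) ⋙ relativeKernelFunctor A B C K ≅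
      relativeKernelFunctor A B C K ⋙
        Scheme.Modules.pullback (thirdTranslationIso₃ A B C c).hom :=
  let p := (pr₁₂ A B C).left
  let τ := (thirdTranslationIso₃ A B C c).hom
  let Q := (Scheme.Modules.pullback (pr₂₃ A B C).left).obj K
  have hQ : IsFiniteLocallyFree Q := hK.pullback _
  have hL' : IsFiniteLocallyFree ((Scheme.Modules.pullback (snd A.X B.X).left).obj L) := hL.pullback _
  -- `(pr_B^*L ⊗ –) ⋙ p^* ⋙ (Q ⊗ –) ≅ p^* ⋙ (p^*pr_B^*L ⊗ –) ⋙ (Q ⊗ –) ≅ p^* ⋙ ((Q ⊗ p^*pr_B^*L) ⊗ –) ≅ p^* ⋙ (τ^*Q ⊗ –)`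
  (Functor.associator _ _ _).symm ≪≫
    Functor.isoWhiskerRight (pullbackTensorNatIsoOfLeft p hL') _ ≪≫
    Functor.associator _ _ _ ≪≫
    Functor.isoWhiskerLeft (Scheme.Modules.pullback p)
      (tensorLeftCompIso Q _ ≪≫ (tensorBifunctor _).mapIso (twistedKernelIso A B C K hK c hL φ)) ≪≫
    -- `≅ (p^* ⋙ τ^*) ⋙ (τ^*Q ⊗ –) ≅ p^* ⋙ (Q ⊗ –) ⋙ τ^*`
    Functor.isoWhiskerRight (pullbackPr₁₂IsoCompTranslateThird A B C c) _ ≪≫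
    Functor.associator _ _ _ ≪≫
    Functor.isoWhiskerLeft (Scheme.Modules.pullback p) (pullbackTensorNatIsoOfLeft τ hQ).symm ≪≫
    (Functor.associator _ _ _).symm

variable [HasDerivedCategory.{w₁} (A.X ⊗ B.X).left.Modules] [HasDerivedCategory.{w₂} ((A.X ⊗ B.X) ⊗ C.X).left.Modules]
  [HasDerivedCategory.{w₃} (A.X ⊗ C.X).left.Modules]

/-- **ROW (ii): `D⁺(pr_B^*L ⊗ –) ⋙ (id × Ψ_K) ≅ (id × Ψ_K) ⋙ D⁺(t_{(1,c)}^*)`** for a line bundle `L` on `B`, GIVEN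
`φ : t_{(1,c)}^*K ≅ K ⊗ pr_B^*L` — the relative form of Mukai's tensor row. Exactness instances of `pr_B^*L ⊗ –` and `t_{(1,c)}^*` are
binders. [cite: Mukai1981, §3 (3.1) p. 158 (RS ∘ (⊗ P_x) ≅ T_x^* ∘ RS)] [cite: Markman2025SecantWeil, §9.3 p. 71 L46–69]
[cite: Hartshorne1977, III Prop. 9.3] -/
def relativeTransform_twist_iso
    [((tensorBifunctor (A.X ⊗ B.X).left).obj ((Scheme.Modules.pullback (snd A.X B.X).left).obj L)).Additive]
    [PreservesFiniteLimits ((tensorBifunctor (A.X ⊗ B.X).left).obj ((Scheme.Modules.pullback (snd A.X B.X).left).obj L))]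
    [PreservesFiniteColimits ((tensorBifunctor (A.X ⊗ B.X).left).obj ((Scheme.Modules.pullback (snd A.X B.X).left).obj L))]
    [PreservesFiniteLimits (Scheme.Modules.pullback (sndTranslationIso C c A).hom)] :
    ((tensorBifunctor (A.X ⊗ B.X).left).obj ((Scheme.Modules.pullback (snd A.X B.X).left).obj L)).mapDerivedCategoryPlus ⋙
        relativeIntegralTransformPlus A B C K hK hK₁ ≅
      relativeIntegralTransformPlus A B C K hK hK₁ ⋙
        (Scheme.Modules.pullback (sndTranslationIso C c A).hom).mapDerivedCategoryPlus := by
  haveI := preservesFiniteLimits_pullback_pr₁₂ A B C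
  haveI := preservesFiniteLimits_tensor_pullback_pr₂₃ A B C K hK hK₁
  haveI := preservesFiniteColimits_tensor_pullback_pr₂₃ A B C K hK hK₁
  haveI := additive_integralKernelFunctor (pr₁₂ A B C).left ((Scheme.Modules.pullback (pr₂₃ A B C).left).obj K)
  haveI := preservesFiniteLimits_integralKernelFunctor (pr₁₂ A B C).left ((Scheme.Modules.pullback (pr₂₃ A B C).left).obj K)
  haveI := preservesFiniteColimits_integralKernelFunctor (pr₁₂ A B C).left ((Scheme.Modules.pullback (pr₂₃ A B C).left).obj K)
  haveI := preservesFiniteLimits_pullback_of_iso (thirdTranslationIso₃ A B C c)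
  let G := relativeKernelFunctor A B C K
  let T := (tensorBifunctor (A.X ⊗ B.X).left).obj ((Scheme.Modules.pullback (snd A.X B.X).left).obj L)
  let τ := Scheme.Modules.pullback (thirdTranslationIso₃ A B C c).hom
  let q := (pr₁₃ A B C).left
  exact (Functor.associator _ _ _).symm ≪≫
    Functor.isoWhiskerRight ((Functor.mapDerivedCategoryPlusCompIso T G).symm ≪≫
      Functor.mapDerivedCategoryPlusIsoOfIso _ _ (relativeKernelTwistNatIso A B C K hK c hL φ) ≪≫
      Functor.mapDerivedCategoryPlusCompIso G τ) (derivedPushforwardPlus q) ≪≫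
    Functor.associator _ _ _ ≪≫
    Functor.isoWhiskerLeft G.mapDerivedCategoryPlus
      (derivedPushforwardPlusBaseChangeIsoOfIso q q (thirdTranslationIso₃ A B C c)
        (sndTranslationIso C c A) (pr₁₃_comp_sndTranslation A B C c)) ≪≫
    (Functor.associator _ _ _).symm

end RowTwist

end Literature.AlgebraicGeometry.AbelianVarieties

end
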